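import Summits.QuantumFields.GaugeBoot.PlanarBootstrapLargeNRateWords
import Literature.Probability.Moments.CovarianceFreezing
import HarnessLib

/-!
# Kazakov–Zheng's class-indexed relaxation variables cost `O(1/N²)` too: the covariance form of the identification defect and the `1/N²` law for the printed format (gauge-boot, large-`N` supplement 18)

HONEST FRAMING (cell `pub-gaugeboot`, page 1 of every file): the venture produces certified bounds
on lattice expectations at stated coupling, gauge group, dimension and torus size; NOT a mass gap,
NOT a continuum limit, NOT a string tension; NOT large `N` unless marked CONDITIONAL; NOT
Yang–Mills-summit-bearing (barriers `FixedCouplingUltralocality`, `PerturbativeInvisibility`).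
The rate statements are CONDITIONAL on the tree's named fact `shenZhuZhu_largeN_variance` (SZZ
CMP 400 (2023) Cor. 1.5 (1.12)); this file certifies no number.

## Content

Supplements 7 and 12 (`PlanarClassIdentificationsZd`, `PlanarClassIdentificationRate`) bounded the
defect of identifying the relaxation variables of SEPARATELY moved pairs — `Q(A', B)` with `Q(A, B)`,
`A'` a translated copy of `A`, as a class-indexed `Q_{ij}` does — by `E‖t_{A'} − E t_{A'}‖ + E‖t_A − E t_A‖`,
i.e. by FIRST powers of standard deviations: `O(1/N)` under SZZ.  That bound throws away the
fluctuation of the partner `t_B` (`|t_B| ≤ 1`).  Keeping it — `Q(A, B) = Re E[t_A t_B] =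
Cov(Re t_A, Re t_B) − Cov(Im t_A, Im t_B) + E Re t_A E Re t_B − E Im t_A E Im t_B` (`loopQ_eq_covariance`)
and Cauchy–Schwarz for each covariance — gives the sharp form:

* ★★ `abs_loopQ_sub_loopQ_le_sqrt_mul` — for any probability state and words with `E t_{A'} = E t_A`,
  `|Q(A', B) − Q(A, B)| ≤ (σ(Re t_{A'}) + σ(Re t_A)) σ(Re t_B) + (σ(Im t_{A'}) + σ(Im t_A)) σ(Im t_B)`
  (`σ = √Var`); ★★ `abs_loopQ_sub_loopQ_le_sqrt_total` — `≤ (√V(t_{A'}) + √V(t_A)) √V(t_B)` with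
  `V(t) = Var Re t + Var Im t` (SZZ's quantity): a PRODUCT of two standard deviations.
* ★★★ `abs_loopQ_conjPath_sub_loopQ_le_of_szz_sharp` — GIVEN SZZ (1.12), `d ≥ 2`,
  `|βt| < 1/(16(d−1))`, `N ≥ 1`, `μ` a thermodynamic limit point of the `SU(N)` torus Wilson states at
  tree coupling `N·βt`, `A, B` closed at `x`, `A' = p·A·p⁻¹`, realising non-backtracking walks for `A`
  (at `x` and at `y = endpoint x p`) and for `B`:
  `|Q_x(A', B) − Q_x(A, B)| ≤ (√K_{A'} + √K_A) √K_B / N²`, `K_C = 4 n_C(n_C − 3)/c₀` —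
  **the class-indexed relaxation variables are consistent at finite `N` up to `O(1/N²)`**, not merely
  `O(1/N)` (supplement 12).
* ★★ `abs_loopQ_conjPath_sub_loopQ_le_of_szz_of_cyclicallyReduced` — the same with decidable side
  conditions only: for CYCLICALLY REDUCED closed words `A, B` (supplement 14) and any path `p`,
  `|Q_x(p·A·p⁻¹, B) − Q_x(A, B)| ≤ 2 √K_A √K_B / N²`, `K_C = 4 |C|(|C| − 3)/c₀` from the word lengths.
* Sequel `PlanarClassRowsRate`: the `1/N²` law for Kazakov–Zheng's printed (class-indexed) format.

So at strong 't Hooft coupling EVERY ingredient of the planar SDP — relaxation wiring, orientation and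
translation class identifications, `SU(N)` row terms — costs `O(1/N²)`, uniformly in the format.
Whether `1/N²` is sharp is not claimed.  [folklore] (Cauchy–Schwarz) on top of SZZ.
-/

noncomputable section

open MeasureTheory ProbabilityTheory
open scoped BigOperators
open Literature.Probability.LatticeModels (Site zdGraph)
open Literature.MathematicalPhysics.QuantumLattice
open Literature.MathematicalPhysics.QuantumFieldTheory (szzThresholdSU shenZhuZhu_largeN_variance IsNonBacktrackingLoop
  wilsonLoopTrace wilsonLoopTrace_apply)
open Literature.Probability.Moments (covariance_sq_le_variance_mul)

namespace Summit.QuantumFields.GaugeBoot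

variable {d N : ℕ}

/-! ## Cauchy–Schwarz for the covariance -/

/-- **Cauchy–Schwarz for the covariance**, square-root form: `|Cov(X, Y)| ≤ σ(X) σ(Y)`. [folklore] -/
theorem abs_covariance_le_sqrt_variance_mul {Ω : Type*} [MeasurableSpace Ω] {μ : Measure Ω} [IsProbabilityMeasure μ]
    {X Y : Ω → ℝ} (hX : MemLp X 2 μ) (hY : MemLp Y 2 μ) :
    |cov[X, Y; μ]| ≤ Real.sqrt (Var[X; μ]) * Real.sqrt (Var[Y; μ]) := by
  rw [← Real.sqrt_mul (variance_nonneg _ _), ← Real.sqrt_sq_eq_abs]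
  exact Real.sqrt_le_sqrt (covariance_sq_le_variance_mul hX hY)

/-! ## `Q(A, B)` in covariances -/

section Covariance

variable {G : Type*} [Group G] [TopologicalSpace G] [IsTopologicalGroup G] [CompactSpace G]
  [MeasurableSpace G] [BorelSpace G] (ρ : G →* Matrix (Fin N) (Fin N) ℂ)

/-- `Re t_C` is square integrable (bounded by `1`) for every finite measure. [folklore] -/
theorem memLp_two_re_loopTrZd (hρ : Continuous ρ) (μ : Measure (LGConfig d G)) [IsFiniteMeasure μ] (x : Site d) (C : Word d) :
    MemLp (fun U => (loopTrZd ρ x C U).re) 2 μ :=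
  MemLp.of_bound (Complex.continuous_re.comp_aestronglyMeasurable (aestronglyMeasurable_loopTrZd ρ hρ μ x C)) 1
    (Filter.Eventually.of_forall fun U => by rw [Real.norm_eq_abs]; exact abs_re_loopTrZd_le_one ρ hρ x C U)

/-- `Im t_C` is square integrable (bounded by `1`) for every finite measure. [folklore] -/
theorem memLp_two_im_loopTrZd (hρ : Continuous ρ) (μ : Measure (LGConfig d G)) [IsFiniteMeasure μ] (x : Site d) (C : Word d) :
    MemLp (fun U => (loopTrZd ρ x C U).im) 2 μ :=
  MemLp.of_bound (Complex.continuous_im.comp_aestronglyMeasurable (aestronglyMeasurable_loopTrZd ρ hρ μ x C)) 1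
    (Filter.Eventually.of_forall fun U => by rw [Real.norm_eq_abs]; exact abs_im_loopTrZd_le_one ρ hρ x C U)

/-- The integrand `Re t_A Re t_B` is integrable (finite measure). [folklore] -/
theorem integrable_re_mul_re (hρ : Continuous ρ) (μ : Measure (LGConfig d G)) [IsFiniteMeasure μ] (x : Site d)
    (A B : Word d) :
    Integrable (fun U => (loopTrZd ρ x A U).re * (loopTrZd ρ x B U).re) μ :=
  (memLp_two_re_loopTrZd ρ hρ μ x A).integrable_mul (memLp_two_re_loopTrZd ρ hρ μ x B)

/-- **`Q(A, B) = E[Re t_A Re t_B] − E[Im t_A Im t_B]`** (`Re(z w) = Re z Re w − Im z Im w`). [folklore] -/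
theorem loopQ_eq_integral_re_mul_re_sub (hρ : Continuous ρ) (μ : Measure (LGConfig d G)) [IsFiniteMeasure μ] (x : Site d)
    (A B : Word d) :
    loopQ ρ μ x A B = (∫ U, (loopTrZd ρ x A U).re * (loopTrZd ρ x B U).re ∂μ) - ∫ U, (loopTrZd ρ x A U).im * (loopTrZd ρ x B U).im ∂μ := by
  have hi := integrable_loopTrZd_mul ρ hρ μ x A B
  have hr := integral_re hi
  simp only [RCLike.re_to_complex] at hr
  rw [loopQ, ← hr, ← integral_sub (integrable_re_mul_re ρ hρ μ x A B) (integrable_im_mul_im ρ hρ μ x A B)]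
  refine integral_congr_ae (Filter.Eventually.of_forall fun U => ?_)
  simp only [Complex.mul_re]

/-- **`Q(A, B)` in covariances** (probability state):
`Q(A, B) = Cov(Re t_A, Re t_B) − Cov(Im t_A, Im t_B) + E Re t_A · E Re t_B − E Im t_A · E Im t_B`. [folklore] -/
theorem loopQ_eq_covariance (hρ : Continuous ρ) (μ : Measure (LGConfig d G)) [IsProbabilityMeasure μ] (x : Site d) (A B : Word d) :
    loopQ ρ μ x A B =
      cov[fun U => (loopTrZd ρ x A U).re, fun U => (loopTrZd ρ x B U).re; μ] -
        cov[fun U => (loopTrZd ρ x A U).im, fun U => (loopTrZd ρ x B U).im; μ] +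
        (∫ U, (loopTrZd ρ x A U).re ∂μ) * (∫ U, (loopTrZd ρ x B U).re ∂μ) -
        (∫ U, (loopTrZd ρ x A U).im ∂μ) * (∫ U, (loopTrZd ρ x B U).im ∂μ) := by
  rw [loopQ_eq_integral_re_mul_re_sub ρ hρ μ x A B,
    covariance_eq_sub (memLp_two_re_loopTrZd ρ hρ μ x A) (memLp_two_re_loopTrZd ρ hρ μ x B),
    covariance_eq_sub (memLp_two_im_loopTrZd ρ hρ μ x A) (memLp_two_im_loopTrZd ρ hρ μ x B)]
  simp only [Pi.mul_apply]
  ring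

/-- ★★ **THE SHARP CLASS-IDENTIFICATION DEFECT**: for a probability state and words `A, A', B` based at
`x` with `E t_{A'} = E t_A` (e.g. `A'` a symmetry-related copy of `A` for a state with that symmetry),
`|Q(A', B) − Q(A, B)| ≤ (σ(Re t_{A'}) + σ(Re t_A)) σ(Re t_B) + (σ(Im t_{A'}) + σ(Im t_A)) σ(Im t_B)`,
`σ = √Var` — a PRODUCT of standard deviations (supplement 7 had a single one). [folklore] -/
theorem abs_loopQ_sub_loopQ_le_sqrt_mul (hρ : Continuous ρ) (μ : Measure (LGConfig d G)) [IsProbabilityMeasure μ] (x : Site d)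
    (A A' B : Word d) (hmean : ∫ U, loopTrZd ρ x A' U ∂μ = ∫ U, loopTrZd ρ x A U ∂μ) :
    |loopQ ρ μ x A' B - loopQ ρ μ x A B| ≤
      (Real.sqrt (Var[fun U => (loopTrZd ρ x A' U).re; μ]) + Real.sqrt (Var[fun U => (loopTrZd ρ x A U).re; μ])) *
          Real.sqrt (Var[fun U => (loopTrZd ρ x B U).re; μ]) +
        (Real.sqrt (Var[fun U => (loopTrZd ρ x A' U).im; μ]) + Real.sqrt (Var[fun U => (loopTrZd ρ x A U).im; μ])) *
          Real.sqrt (Var[fun U => (loopTrZd ρ x B U).im; μ]) := by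
  -- the means of the real and imaginary parts agree
  have hiA := integrable_loopTrZd ρ hρ μ x A
  have hiA' := integrable_loopTrZd ρ hρ μ x A'
  have hre : ∫ U, (loopTrZd ρ x A' U).re ∂μ = ∫ U, (loopTrZd ρ x A U).re ∂μ := by
    have h1 := integral_re hiA'
    have h2 := integral_re hiA
    simp only [RCLike.re_to_complex] at h1 h2
    rw [h1, h2, hmean]
  have him : ∫ U, (loopTrZd ρ x A' U).im ∂μ = ∫ U, (loopTrZd ρ x A U).im ∂μ := by
    have h1 := integral_im hiA'
    have h2 := integral_im hiA
    simp only [RCLike.im_to_complex] at h1 h2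
    rw [h1, h2, hmean]
  rw [loopQ_eq_covariance ρ hρ μ x A' B, loopQ_eq_covariance ρ hρ μ x A B, hre, him]
  -- four Cauchy–Schwarz bounds
  have h1 := abs_covariance_le_sqrt_variance_mul (memLp_two_re_loopTrZd ρ hρ μ x A') (memLp_two_re_loopTrZd ρ hρ μ x B)
  have h2 := abs_covariance_le_sqrt_variance_mul (memLp_two_re_loopTrZd ρ hρ μ x A) (memLp_two_re_loopTrZd ρ hρ μ x B)
  have h3 := abs_covariance_le_sqrt_variance_mul (memLp_two_im_loopTrZd ρ hρ μ x A') (memLp_two_im_loopTrZd ρ hρ μ x B)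
  have h4 := abs_covariance_le_sqrt_variance_mul (memLp_two_im_loopTrZd ρ hρ μ x A) (memLp_two_im_loopTrZd ρ hρ μ x B)
  set c1' := cov[fun U => (loopTrZd ρ x A' U).re, fun U => (loopTrZd ρ x B U).re; μ]
  set c1 := cov[fun U => (loopTrZd ρ x A U).re, fun U => (loopTrZd ρ x B U).re; μ]
  set c2' := cov[fun U => (loopTrZd ρ x A' U).im, fun U => (loopTrZd ρ x B U).im; μ]
  set c2 := cov[fun U => (loopTrZd ρ x A U).im, fun U => (loopTrZd ρ x B U).im; μ]
  set mA := ∫ U, (loopTrZd ρ x A U).re ∂μ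
  set mB := ∫ U, (loopTrZd ρ x B U).re ∂μ
  set nA := ∫ U, (loopTrZd ρ x A U).im ∂μ
  set nB := ∫ U, (loopTrZd ρ x B U).im ∂μ
  have e : c1' - c2' + mA * mB - nA * nB - (c1 - c2 + mA * mB - nA * nB) = (c1' - c1) - (c2' - c2) := by ring
  rw [e]
  have hu : |(c1' - c1) - (c2' - c2)| ≤ |c1'| + |c1| + (|c2'| + |c2|) :=
    (abs_sub _ _).trans (add_le_add (abs_sub _ _) (abs_sub _ _))
  have hexp : (Real.sqrt (Var[fun U => (loopTrZd ρ x A' U).re; μ]) + Real.sqrt (Var[fun U => (loopTrZd ρ x A U).re; μ])) *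
          Real.sqrt (Var[fun U => (loopTrZd ρ x B U).re; μ]) +
        (Real.sqrt (Var[fun U => (loopTrZd ρ x A' U).im; μ]) + Real.sqrt (Var[fun U => (loopTrZd ρ x A U).im; μ])) *
          Real.sqrt (Var[fun U => (loopTrZd ρ x B U).im; μ]) =
      Real.sqrt (Var[fun U => (loopTrZd ρ x A' U).re; μ]) * Real.sqrt (Var[fun U => (loopTrZd ρ x B U).re; μ]) +
        Real.sqrt (Var[fun U => (loopTrZd ρ x A U).re; μ]) * Real.sqrt (Var[fun U => (loopTrZd ρ x B U).re; μ]) +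
        (Real.sqrt (Var[fun U => (loopTrZd ρ x A' U).im; μ]) * Real.sqrt (Var[fun U => (loopTrZd ρ x B U).im; μ]) +
          Real.sqrt (Var[fun U => (loopTrZd ρ x A U).im; μ]) * Real.sqrt (Var[fun U => (loopTrZd ρ x B U).im; μ])) := by
    ring
  rw [hexp]
  linarith

/-- ★★ **The same with SZZ's total variance `V(t) = Var Re t + Var Im t`**:
`|Q(A', B) − Q(A, B)| ≤ (√V(t_{A'}) + √V(t_A)) · √V(t_B)`. [folklore] -/
theorem abs_loopQ_sub_loopQ_le_sqrt_total (hρ : Continuous ρ) (μ : Measure (LGConfig d G)) [IsProbabilityMeasure μ] (x : Site d)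
    (A A' B : Word d) (hmean : ∫ U, loopTrZd ρ x A' U ∂μ = ∫ U, loopTrZd ρ x A U ∂μ) :
    |loopQ ρ μ x A' B - loopQ ρ μ x A B| ≤
      (Real.sqrt (Var[fun U => (loopTrZd ρ x A' U).re; μ] + Var[fun U => (loopTrZd ρ x A' U).im; μ]) +
          Real.sqrt (Var[fun U => (loopTrZd ρ x A U).re; μ] + Var[fun U => (loopTrZd ρ x A U).im; μ])) *
        Real.sqrt (Var[fun U => (loopTrZd ρ x B U).re; μ] + Var[fun U => (loopTrZd ρ x B U).im; μ]) := by
  refine (abs_loopQ_sub_loopQ_le_sqrt_mul ρ hρ μ x A A' B hmean).trans ?_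
  -- Cauchy–Schwarz in `ℝ²`: `√a √b + √c √e ≤ √(a + c) √(b + e)` (as in the tree's `DirichletRingEnergies`)
  have sqrt_mul_sqrt_add_le : ∀ {a b c e : ℝ}, 0 ≤ a → 0 ≤ b → 0 ≤ c → 0 ≤ e →
      Real.sqrt a * Real.sqrt b + Real.sqrt c * Real.sqrt e ≤ Real.sqrt (a + c) * Real.sqrt (b + e) := by
    intro a b c e ha hb hc he
    have hpa := Real.sq_sqrt ha
    have hpb := Real.sq_sqrt hb
    have hpc := Real.sq_sqrt hc
    have hpe := Real.sq_sqrt he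
    have h0 : 0 ≤ Real.sqrt a * Real.sqrt b + Real.sqrt c * Real.sqrt e := by positivity
    rw [← Real.sqrt_sq h0, ← Real.sqrt_mul (add_nonneg ha hc) (b + e)]
    refine Real.sqrt_le_sqrt ?_
    nlinarith [sq_nonneg (Real.sqrt a * Real.sqrt e - Real.sqrt c * Real.sqrt b), Real.sqrt_nonneg a, Real.sqrt_nonneg b,
      Real.sqrt_nonneg c, Real.sqrt_nonneg e]
  have hA' := sqrt_mul_sqrt_add_le (variance_nonneg (fun U => (loopTrZd ρ x A' U).re) μ)
    (variance_nonneg (fun U => (loopTrZd ρ x B U).re) μ) (variance_nonneg (fun U => (loopTrZd ρ x A' U).im) μ)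
    (variance_nonneg (fun U => (loopTrZd ρ x B U).im) μ)
  have hA := sqrt_mul_sqrt_add_le (variance_nonneg (fun U => (loopTrZd ρ x A U).re) μ)
    (variance_nonneg (fun U => (loopTrZd ρ x B U).re) μ) (variance_nonneg (fun U => (loopTrZd ρ x A U).im) μ)
    (variance_nonneg (fun U => (loopTrZd ρ x B U).im) μ)
  linarith

end Covariance

/-! ## Given SZZ: the class-indexed format costs `O(1/N²)` -/

/-- ★★★ **KZ's CLASS-INDEXED RELAXATION VARIABLES ARE CONSISTENT AT FINITE `N` UP TO `O(1/N²)`** (given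
SZZ (1.12)): `d ≥ 2`, `|βt| < 1/(16(d−1))`, `N ≥ 1`, `μ` a thermodynamic limit point of the `SU(N)` torus
Wilson states at tree coupling `N·βt`; `A, B` closed at `x`, `p` a path from `x` to `y`, `A' = p·A·p⁻¹`;
non-backtracking closed walks `γ` (at `x`) and `γ'` (at `y`) realising `A`, `γ_B` realising `B` at `x`.
Then `|Q_x(A', B) − Q_x(A, B)| ≤ (√K_{γ'} + √K_γ) √K_{γ_B} / N²` with `K_δ = 4 n_δ(n_δ−3)/c₀`.
[cite: ShenZhuZhuCMP2023, Corollary 1.5] -/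
theorem abs_loopQ_conjPath_sub_loopQ_le_of_szz_sharp (hfact : ∀ N, shenZhuZhu_largeN_variance d N) (hd : 2 ≤ d) {βt : ℝ}
    (hβ : |βt| < szzThresholdSU d) (hN : 1 ≤ N) {μ : Measure (LGConfig d (Matrix.specialUnitaryGroup (Fin N) ℂ))}
    (hμ : μ ∈ infiniteVolumeLimitPoints (d := d) (fundamentalRep (Fin N)) ((N : ℝ) * βt))
    (x : Site d) (p A B : Word d) (hA : Word.endpointZd x A = x)
    (γ : (zdGraph d).Walk x x) (hγ : IsNonBacktrackingLoop γ)
    (hhol : ∀ U : LGConfig d (Matrix.specialUnitaryGroup (Fin N) ℂ), walkHolonomy U γ = wordHolonomyZd U x A)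
    (γ' : (zdGraph d).Walk (Word.endpointZd x p) (Word.endpointZd x p)) (hγ' : IsNonBacktrackingLoop γ')
    (hhol' : ∀ U : LGConfig d (Matrix.specialUnitaryGroup (Fin N) ℂ), walkHolonomy U γ' = wordHolonomyZd U (Word.endpointZd x p) A)
    (γB : (zdGraph d).Walk x x) (hγB : IsNonBacktrackingLoop γB)
    (hholB : ∀ U : LGConfig d (Matrix.specialUnitaryGroup (Fin N) ℂ), walkHolonomy U γB = wordHolonomyZd U x B) :
    |loopQ (fundamentalRep (Fin N)) μ x (p ++ A ++ p.reverse) B - loopQ (fundamentalRep (Fin N)) μ x A B| ≤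
      (Real.sqrt (4 * ((γ'.length : ℝ) * ((γ'.length : ℝ) - 3)) / szzPlanarSlope d βt) +
          Real.sqrt (4 * ((γ.length : ℝ) * ((γ.length : ℝ) - 3)) / szzPlanarSlope d βt)) *
        Real.sqrt (4 * ((γB.length : ℝ) * ((γB.length : ℝ) - 3)) / szzPlanarSlope d βt) / (N : ℝ) ^ 2 := by
  haveI : SecondCountableTopology (Matrix (Fin N) (Fin N) ℂ) :=
    inferInstanceAs (SecondCountableTopology (Fin N → Fin N → ℂ))
  haveI : SecondCountableTopology (Matrix.specialUnitaryGroup (Fin N) ℂ) :=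
    Topology.IsEmbedding.subtypeVal.secondCountableTopology
  haveI : IsProbabilityMeasure μ := by obtain ⟨L, -, hL⟩ := hμ; exact hL.1
  have hT : IsZdTranslationInvariant μ := isZdTranslationInvariant_of_mem_infiniteVolumeLimitPoints (fundamentalRep (Fin N)) hμ
  have hρ := continuous_fundamentalRep (Fin N)
  have hA' : Word.endpointZd (Word.endpointZd x p) A = Word.endpointZd x p := Word.endpointZd_eq_self_of_closed hA _
  have hmean : ∫ U, loopTrZd (fundamentalRep (Fin N)) x (p ++ A ++ p.reverse) U ∂μ = ∫ U, loopTrZd (fundamentalRep (Fin N)) x A U ∂μ := by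
    simp only [loopTrZd_conjPath _ x p A hA', loopTrZd_apply, integral_div]
    rw [show Word.endpointZd x p = x + (Word.endpointZd x p - x) by abel, integral_trace_wordHolonomyZd_add _ hT]
  refine (abs_loopQ_sub_loopQ_le_sqrt_total _ hρ μ x A _ B hmean).trans ?_
  have hN' : (0 : ℝ) < N := by exact_mod_cast hN
  -- each total standard deviation is `≤ √K / N`
  have hsA' : Real.sqrt (Var[fun U => (loopTrZd (fundamentalRep (Fin N)) x (p ++ A ++ p.reverse) U).re; μ] +
        Var[fun U => (loopTrZd (fundamentalRep (Fin N)) x (p ++ A ++ p.reverse) U).im; μ]) ≤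
      Real.sqrt (4 * ((γ'.length : ℝ) * ((γ'.length : ℝ) - 3)) / szzPlanarSlope d βt) / N := by
    have hv := variance_loopTrZd_le_of_szz hfact hd hβ hN hμ (Word.endpointZd x p) A γ' hγ' hhol'
    refine sqrt_le_sqrt_div_of_le hN ?_
    have e1 : (fun U => (loopTrZd (fundamentalRep (Fin N)) x (p ++ A ++ p.reverse) U).re) =
        fun U => (loopTrZd (fundamentalRep (Fin N)) (Word.endpointZd x p) A U).re :=
      funext fun U => by rw [loopTrZd_conjPath _ x p A hA' U]
    have e2 : (fun U => (loopTrZd (fundamentalRep (Fin N)) x (p ++ A ++ p.reverse) U).im) =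
        fun U => (loopTrZd (fundamentalRep (Fin N)) (Word.endpointZd x p) A U).im :=
      funext fun U => by rw [loopTrZd_conjPath _ x p A hA' U]
    rw [e1, e2]
    exact hv
  have hsA : Real.sqrt (Var[fun U => (loopTrZd (fundamentalRep (Fin N)) x A U).re; μ] +
        Var[fun U => (loopTrZd (fundamentalRep (Fin N)) x A U).im; μ]) ≤
      Real.sqrt (4 * ((γ.length : ℝ) * ((γ.length : ℝ) - 3)) / szzPlanarSlope d βt) / N :=
    sqrt_le_sqrt_div_of_le hN (variance_loopTrZd_le_of_szz hfact hd hβ hN hμ x A γ hγ hhol)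
  have hsB : Real.sqrt (Var[fun U => (loopTrZd (fundamentalRep (Fin N)) x B U).re; μ] +
        Var[fun U => (loopTrZd (fundamentalRep (Fin N)) x B U).im; μ]) ≤
      Real.sqrt (4 * ((γB.length : ℝ) * ((γB.length : ℝ) - 3)) / szzPlanarSlope d βt) / N :=
    sqrt_le_sqrt_div_of_le hN (variance_loopTrZd_le_of_szz hfact hd hβ hN hμ x B γB hγB hholB)
  calc _ ≤ (Real.sqrt (4 * ((γ'.length : ℝ) * ((γ'.length : ℝ) - 3)) / szzPlanarSlope d βt) / N +
          Real.sqrt (4 * ((γ.length : ℝ) * ((γ.length : ℝ) - 3)) / szzPlanarSlope d βt) / N) *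
        (Real.sqrt (4 * ((γB.length : ℝ) * ((γB.length : ℝ) - 3)) / szzPlanarSlope d βt) / N) :=
        mul_le_mul (add_le_add hsA' hsA) hsB (Real.sqrt_nonneg _) (by positivity)
    _ = _ := by
        field_simp



/-- ★★ **The class-identification defect with decidable side conditions only** (given SZZ (1.12)):
for CYCLICALLY REDUCED words `A, B` closed at `x` and any path word `p`,
`|Q_x(p·A·p⁻¹, B) − Q_x(A, B)| ≤ 2 √K_A √K_B / N²` with `K_C = 4 |C|(|C|−3)/c₀` (`d ≥ 2`,
`|βt| < 1/(16(d−1))`, `N ≥ 1`, `μ` a thermodynamic limit point of the `SU(N)` torus states at tree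
coupling `N·βt`). [cite: ShenZhuZhuCMP2023, Corollary 1.5] -/
theorem abs_loopQ_conjPath_sub_loopQ_le_of_szz_of_cyclicallyReduced (hfact : ∀ N, shenZhuZhu_largeN_variance d N) (hd : 2 ≤ d)
    {βt : ℝ} (hβ : |βt| < szzThresholdSU d) (hN : 1 ≤ N) {μ : Measure (LGConfig d (Matrix.specialUnitaryGroup (Fin N) ℂ))}
    (hμ : μ ∈ infiniteVolumeLimitPoints (d := d) (fundamentalRep (Fin N)) ((N : ℝ) * βt))
    (x : Site d) (p A B : Word d) (hA : Word.endpointZd x A = x) (hB : Word.endpointZd x B = x)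
    (hredA : A.CyclicallyReduced) (hredB : B.CyclicallyReduced) :
    |loopQ (fundamentalRep (Fin N)) μ x (p ++ A ++ p.reverse) B - loopQ (fundamentalRep (Fin N)) μ x A B| ≤
      2 * Real.sqrt (4 * ((A.length : ℝ) * ((A.length : ℝ) - 3)) / szzPlanarSlope d βt) *
        Real.sqrt (4 * ((B.length : ℝ) * ((B.length : ℝ) - 3)) / szzPlanarSlope d βt) / (N : ℝ) ^ 2 := by
  have hA' : Word.endpointZd (Word.endpointZd x p) A = Word.endpointZd x p := Word.endpointZd_eq_self_of_closed hA _
  have h := abs_loopQ_conjPath_sub_loopQ_le_of_szz_sharp hfact hd hβ hN hμ x p A B hA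
    (Word.toLoopZd x A hA) (isNonBacktrackingLoop_toLoopZd x A hA hredA) (fun U => walkHolonomy_toLoopZd U x A hA)
    (Word.toLoopZd (Word.endpointZd x p) A hA') (isNonBacktrackingLoop_toLoopZd _ A hA' hredA)
    (fun U => walkHolonomy_toLoopZd U _ A hA')
    (Word.toLoopZd x B hB) (isNonBacktrackingLoop_toLoopZd x B hB hredB) (fun U => walkHolonomy_toLoopZd U x B hB)
  simp only [Word.length_toLoopZd] at h
  refine h.trans (le_of_eq ?_)
  ring

end Summit.QuantumFields.GaugeBoot

end
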